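import Summits.HubbardSuperconductivity.HubbardLadder.HubbardTwoPolePencil
import HarnessLib

/-!
# The two-pole (`2 × 2`) semidefinite certificate, II: closed form and optimality

HONEST FRAMING (page 1): ladder R1–R4 with certified numbers; no claim on H/H₀; first certified
bounds; not a superconductivity verdict. A lemma about a `2 × 2` semidefinite programme; it claims nothing
about the Hubbard model beyond the certificate-form bound it is combined with (pub-hubbard cell, seat
`pseudo` g64, `PSEUDO.md` §110 / `TO-ENG.md` §C 130; staged, NOT filed — the FILER decision is the desk's).

FILE SPLIT (400-line rule): part II of the master file `TwoPoleCertificateClosedForm.lean`; imports part I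
(`HubbardTwoPolePencil`: `symTwo`, minors criterion, `M(ρ)`, `M(ρ)⁻¹`, weak duality, pencil invariants,
positivity of the pencils). Proved here, for real `a b d` and `0 < ρ < 1`, `C = symTwo a b d`,
`M = symTwo 1 ρ ρ`, `e± = rootHi/rootLo`:
* `exists_certificate`: an explicit `T ⪰ 0` with `C + T ⪰ 0` and `-Re tr(T M) = min 0 e₊ + min 0 e₋`
  (`T = 0` if `e₋ ≥ 0`; `T = -C` if `e₊ ≤ 0`; `T = (-e₋/(e₊-e₋))·(e₊ M⁻¹ - C)` if `e₋ < 0 < e₊`);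
* `neg_re_trace_mul_le_certValue`: every admissible `T` has `-Re tr(T M) ≤ min 0 e₊ + min 0 e₋`
  (primal witnesses `G = 0`, `G = M`, `G = M (e₊ M⁻¹ - C) Mᴴ/(e₊-e₋)`, `0 ⪯ G ⪯ M`);
* `isGreatest_certValue`: hence `certValue a b d ρ` is the maximum of the certificate programme;
* `exists_twoPole_certificate`, `twoPole_certificate_optimal`: the same for the LITERAL two-pole cost
  matrix `!![ε + μ, λ/2; λ/2, U/2 - λ]` and moment matrix `!![1, ρ; ρ, ρ]` of `HubbardTwoPoleFrame`
  (`twoPoleCost`, `twoPoleGram`), so the files combine by `rfl` on the matrices.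
Elementary; [folklore] (strong duality for a `2 × 2` semidefinite programme, made explicit).
All statements are PROVED (no placeholders, no named facts); no new axioms, no instances, no notation.
The body below is byte-identical to the master.
-/

noncomputable section

open Matrix
open scoped ComplexOrder ComplexConjugate Matrix

namespace Summit.HubbardSuperconductivity.HubbardLadder

namespace TwoPoleCertificate

/-! ## The optimal certificate -/

/-- Case `e₋ ≥ 0`: `C = P₋ + e₋ M⁻¹ ⪰ 0`, so `T = 0` is admissible. -/
theorem posSemidef_cost_of_rootLo_nonneg (a b d : ℝ) {ρ : ℝ} (h0 : 0 < ρ) (h1 : ρ < 1)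
    (hlo : 0 ≤ rootLo a b d ρ) : (symTwo a b d).PosSemidef := by
  have hP := posSemidef_neg_pencil_rootLo a b d h0 h1
  have hQ := posSemidef_symTwo_scale hlo (posSemidef_gramInv h0 h1)
  rw [pencil, neg_symTwo] at hP
  have hsum := hP.add hQ
  rw [symTwo_add] at hsum
  convert hsum using 2 <;> ring

/-- Case `e₊ ≤ 0`: `-C = P₊ + (-e₊) M⁻¹ ⪰ 0`, so `T = -C` is admissible. -/
theorem posSemidef_neg_cost_of_rootHi_nonpos (a b d : ℝ) {ρ : ℝ} (h0 : 0 < ρ) (h1 : ρ < 1)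
    (hhi : rootHi a b d ρ ≤ 0) : (symTwo (-a) (-b) (-d)).PosSemidef := by
  have hP := posSemidef_pencil_rootHi a b d h0 h1
  have hQ := posSemidef_symTwo_scale (neg_nonneg.mpr hhi) (posSemidef_gramInv h0 h1)
  rw [pencil] at hP
  have hsum := hP.add hQ
  rw [symTwo_add] at hsum
  convert hsum using 2 <;> ring

/-- **The optimal certificate exists in closed form.** For real `a b d` and `0 < ρ < 1` there is
`T ⪰ 0` with `C + T ⪰ 0` and `-Re tr(T M) = min 0 e₊ + min 0 e₋`; explicitly `T = 0`
(`e₋ ≥ 0`), `T = -C` (`e₊ ≤ 0`), `T = (-e₋/(e₊ - e₋)) · (e₊ M⁻¹ - C)` (`e₋ < 0 < e₊`). -/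
theorem exists_certificate (a b d : ℝ) {ρ : ℝ} (h0 : 0 < ρ) (h1 : ρ < 1) :
    ∃ T : Matrix (Fin 2) (Fin 2) ℂ, T.PosSemidef ∧ (symTwo a b d + T).PosSemidef ∧
      -((T * symTwo 1 ρ ρ).trace).re = certValue a b d ρ := by
  have hle := rootLo_le_rootHi a b d ρ
  by_cases hlo : 0 ≤ rootLo a b d ρ
  · -- `T = 0`
    refine ⟨0, Matrix.PosSemidef.zero, ?_, ?_⟩
    · rw [add_zero]
      exact posSemidef_cost_of_rootLo_nonneg a b d h0 h1 hlo
    · rw [zero_mul, trace_zero, Complex.zero_re, neg_zero, certValue, min_eq_left hlo,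
        min_eq_left (hlo.trans hle), add_zero]
  rw [not_le] at hlo
  by_cases hhi : rootHi a b d ρ ≤ 0
  · -- `T = -C`
    refine ⟨symTwo (-a) (-b) (-d), posSemidef_neg_cost_of_rootHi_nonpos a b d h0 h1 hhi, ?_, ?_⟩
    · rw [symTwo_add, add_neg_cancel, add_neg_cancel, add_neg_cancel, symTwo_zero]
      exact Matrix.PosSemidef.zero
    · rw [trace_symTwo_mul_symTwo, Complex.ofReal_re, certValue, min_eq_right hhi,
        min_eq_right hlo.le, rootHi_add_rootLo, pencilTrace]
      ring
  rw [not_le] at hhi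
  -- `e₋ < 0 < e₊`: `T = c · P₊`, `c = -e₋/(e₊ - e₋)`, and `C + T = k · P₋`, `k = e₊/(e₊ - e₋)`.
  have hP := posSemidef_pencil_rootHi a b d h0 h1
  have hQ := posSemidef_neg_pencil_rootLo a b d h0 h1
  rw [pencil] at hP
  rw [pencil, neg_symTwo] at hQ
  have hτ : rootHi a b d ρ + rootLo a b d ρ = pencilTrace a b d ρ := rootHi_add_rootLo a b d ρ
  rw [certValue]
  generalize rootHi a b d ρ = hi at *
  generalize rootLo a b d ρ = lo at *
  rw [min_eq_left hhi.le, min_eq_right hlo.le, zero_add]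
  have hs : 0 < hi - lo := by linarith
  have hs' : hi - lo ≠ 0 := hs.ne'
  have h1' : (1 : ℝ) - ρ ≠ 0 := by intro h; linarith
  have hρ : ρ ≠ 0 := h0.ne'
  have hc : 0 ≤ -lo / (hi - lo) := div_nonneg (by linarith) hs.le
  have hk : 0 ≤ hi / (hi - lo) := div_nonneg hhi.le hs.le
  refine ⟨symTwo (-lo / (hi - lo) * (hi / (1 - ρ) - a)) (-lo / (hi - lo) * (-(hi / (1 - ρ)) - b))
      (-lo / (hi - lo) * (hi / (ρ * (1 - ρ)) - d)), posSemidef_symTwo_scale hc hP, ?_, ?_⟩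
  · -- `C + T = k · P₋ ⪰ 0`
    have hkQ := posSemidef_symTwo_scale hk hQ
    rw [symTwo_add]
    convert hkQ using 2 <;> field_simp <;> ring
  · -- the value `-Re tr(T M) = e₋` (uses `τ = e₊ + e₋`, i.e. `a = e₊ + e₋ - 2ρb - ρd`)
    rw [trace_symTwo_mul_symTwo, Complex.ofReal_re]
    have ha : a = hi + lo - 2 * ρ * b - ρ * d := by
      rw [pencilTrace] at hτ
      linarith
    subst ha
    field_simp
    ring

/-- **Weak duality: the closed form is optimal.** Every admissible certificate `T ⪰ 0`,
`C + T ⪰ 0` has `-Re tr(T M) ≤ min 0 e₊ + min 0 e₋` (primal witnesses `G = 0`, `G = M`,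
`G = M (e₊ M⁻¹ - C) Mᴴ / (e₊ - e₋)`). -/
theorem neg_re_trace_mul_le_certValue (a b d : ℝ) {ρ : ℝ} (h0 : 0 < ρ) (h1 : ρ < 1)
    {T : Matrix (Fin 2) (Fin 2) ℂ} (hT : T.PosSemidef) (hCT : (symTwo a b d + T).PosSemidef) :
    -((T * symTwo 1 ρ ρ).trace).re ≤ certValue a b d ρ := by
  have hle := rootLo_le_rootHi a b d ρ
  have hM := posSemidef_gram h0.le h1.le
  rcases le_or_gt 0 (rootLo a b d ρ) with hlo | hlo
  · -- `G = 0`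
    have h := neg_re_trace_mul_le_of_primal (M := symTwo 1 ρ ρ) (G := 0) hT hCT
      Matrix.PosSemidef.zero (by rw [sub_zero]; exact hM)
    rw [mul_zero, trace_zero, Complex.zero_re] at h
    rw [certValue, min_eq_left hlo, min_eq_left (hlo.trans hle), add_zero]
    exact h
  rcases le_or_gt (rootHi a b d ρ) 0 with hhi | hhi
  · -- `G = M`
    have h := neg_re_trace_mul_le_of_primal (M := symTwo 1 ρ ρ) (G := symTwo 1 ρ ρ) hT hCT hM
      (by rw [sub_self]; exact Matrix.PosSemidef.zero)
    rw [pencilTrace_eq_re_trace] at h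
    rw [certValue, min_eq_right hhi, min_eq_right hlo.le, rootHi_add_rootLo]
    exact h
  -- `e₋ < 0 < e₊`: `G = M (c · P₊) Mᴴ`, `M - G = M (c · P₋) Mᴴ`, `c = 1/(e₊ - e₋)`.
  have hP := posSemidef_pencil_rootHi a b d h0 h1
  have hQ := posSemidef_neg_pencil_rootLo a b d h0 h1
  rw [pencil] at hP
  rw [pencil, neg_symTwo] at hQ
  have hτ : rootHi a b d ρ + rootLo a b d ρ = pencilTrace a b d ρ := rootHi_add_rootLo a b d ρ
  have hΔ : rootHi a b d ρ * rootLo a b d ρ = pencilDet a b d ρ := rootHi_mul_rootLo a b d h0.le h1.le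
  rw [certValue]
  generalize rootHi a b d ρ = hi at *
  generalize rootLo a b d ρ = lo at *
  rw [min_eq_left hhi.le, min_eq_right hlo.le, zero_add]
  have hs : 0 < hi - lo := by linarith
  have hs' : hi - lo ≠ 0 := hs.ne'
  have h1' : (1 : ℝ) - ρ ≠ 0 := by intro h; linarith
  have hρ : ρ ≠ 0 := h0.ne'
  have hc : 0 ≤ 1 / (hi - lo) := (one_div_pos.mpr hs).le
  have hG := (posSemidef_symTwo_scale hc hP).mul_mul_conjTranspose_same (symTwo 1 ρ ρ)
  have hMG := (posSemidef_symTwo_scale hc hQ).mul_mul_conjTranspose_same (symTwo 1 ρ ρ)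
  rw [gram_mul_symTwo_mul_gram] at hG hMG
  have h := neg_re_trace_mul_le_of_primal (M := symTwo 1 ρ ρ) hT hCT hG (by
    rw [symTwo_sub]
    convert hMG using 2 <;> field_simp <;> ring)
  rw [trace_symTwo_mul_symTwo, Complex.ofReal_re] at h
  refine le_trans h (le_of_eq ?_)
  -- the value `Re tr(C G) = e₋` (uses `τ = e₊ + e₋` and `Δ = e₊ e₋`)
  have ha : a = hi + lo - 2 * ρ * b - ρ * d := by
    rw [pencilTrace] at hτ
    linarith
  subst ha
  rw [← sub_eq_zero]
  calc _ = 2 / (hi - lo) * (pencilDet (hi + lo - 2 * ρ * b - ρ * d) b d ρ - hi * lo) := by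
        simp only [pencilDet]
        field_simp
        ring
    _ = 0 := by rw [← hΔ, sub_self, mul_zero]

/-- The closed form `certValue a b d ρ = min 0 e₊ + min 0 e₋` is the MAXIMUM of
`{-Re tr(T M(ρ)) : T ⪰ 0, C + T ⪰ 0}` (strong duality for the `2 × 2` certificate programme,
explicit). -/
theorem isGreatest_certValue (a b d : ℝ) {ρ : ℝ} (h0 : 0 < ρ) (h1 : ρ < 1) :
    IsGreatest {v : ℝ | ∃ T : Matrix (Fin 2) (Fin 2) ℂ, T.PosSemidef ∧
      (symTwo a b d + T).PosSemidef ∧ v = -((T * symTwo 1 ρ ρ).trace).re} (certValue a b d ρ) := by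
  constructor
  · obtain ⟨T, hT, hCT, hv⟩ := exists_certificate a b d h0 h1
    exact ⟨T, hT, hCT, hv.symm⟩
  · rintro v ⟨T, hT, hCT, rfl⟩
    exact neg_re_trace_mul_le_certValue a b d h0 h1 hT hCT

end TwoPoleCertificate

/-! ## Specialisation to the two-pole cost and moment matrices (literal form) -/

open TwoPoleCertificate

/-- **Two-pole certificate, closed form.** For the cost matrix
`C = !![ε + μ, λ/2; λ/2, U/2 - λ]` and the moment matrix `M(ρ) = !![1, ρ; ρ, ρ]`, `0 < ρ < 1`,
there is an admissible certificate `T ⪰ 0`, `C + T ⪰ 0` with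
`Re tr(T M(ρ)) = -certValue (ε + μ) (λ/2) (U/2 - λ) ρ = -(min 0 e₊ + min 0 e₋)`. The matrices
are written literally as in the certificate-form two-pole bound, so the two combine by `rfl`. -/
theorem exists_twoPole_certificate (U ε μ lam : ℝ) {ρ : ℝ} (h0 : 0 < ρ) (h1 : ρ < 1) :
    ∃ T : Matrix (Fin 2) (Fin 2) ℂ, T.PosSemidef ∧
      (!![((ε + μ : ℝ) : ℂ), ((lam / 2 : ℝ) : ℂ); ((lam / 2 : ℝ) : ℂ), ((U / 2 - lam : ℝ) : ℂ)] +
        T).PosSemidef ∧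
      ((T * !![(1 : ℂ), (ρ : ℂ); (ρ : ℂ), (ρ : ℂ)]).trace).re =
        -certValue (ε + μ) (lam / 2) (U / 2 - lam) ρ := by
  obtain ⟨T, hT, hCT, hval⟩ := exists_certificate (ε + μ) (lam / 2) (U / 2 - lam) h0 h1
  have hM : (!![(1 : ℂ), (ρ : ℂ); (ρ : ℂ), (ρ : ℂ)] : Matrix (Fin 2) (Fin 2) ℂ) = symTwo 1 ρ ρ := by
    rw [symTwo, Complex.ofReal_one]
  refine ⟨T, hT, hCT, ?_⟩
  rw [hM]
  linarith

/-- **Optimality of the closed form.** No admissible certificate for the two-pole cost matrix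
does better: `Re tr(T M(ρ)) ≥ -certValue (ε + μ) (λ/2) (U/2 - λ) ρ` whenever `T ⪰ 0` and
`C + T ⪰ 0`. -/
theorem twoPole_certificate_optimal (U ε μ lam : ℝ) {ρ : ℝ} (h0 : 0 < ρ) (h1 : ρ < 1)
    {T : Matrix (Fin 2) (Fin 2) ℂ} (hT : T.PosSemidef)
    (hCT : (!![((ε + μ : ℝ) : ℂ), ((lam / 2 : ℝ) : ℂ); ((lam / 2 : ℝ) : ℂ), ((U / 2 - lam : ℝ) : ℂ)] +
      T).PosSemidef) :
    -certValue (ε + μ) (lam / 2) (U / 2 - lam) ρ ≤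
      ((T * !![(1 : ℂ), (ρ : ℂ); (ρ : ℂ), (ρ : ℂ)]).trace).re := by
  have hM : (!![(1 : ℂ), (ρ : ℂ); (ρ : ℂ), (ρ : ℂ)] : Matrix (Fin 2) (Fin 2) ℂ) = symTwo 1 ρ ρ := by
    rw [symTwo, Complex.ofReal_one]
  have h := neg_re_trace_mul_le_certValue (ε + μ) (lam / 2) (U / 2 - lam) h0 h1 hT hCT
  rw [hM]
  linarith

end Summit.HubbardSuperconductivity.HubbardLadder
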